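import Literature.NumberTheory.EllipticCurves.ManinConstantSemistableTwistProofs
import Literature.RingTheory.PowerSeries.WeierstrassRootIntegralitySharp
import HarnessLib

/-!
# The Manin constant at a prime with a semistable twist: the wild case `k ≥ e` via the sharp
# (Newton-polygon) lemma and a torsion slope (model-free; every `p`; proofs only)

Topic `NumberTheory/EllipticCurves` (theorems only; no definition, no named fact). In support of
the named fact `Literature.NumberTheory.EllipticCurves.edixhoven_int_of_neronLattice_eq_smul_periodLattice`
(Edixhoven 1991, Prop. 2). `ManinConstantSemistableTwistProofs` proves `‖q‖_p ≤ 1` from a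
finite-height twist `V'' = (πᵏ, r, s, t) • (W' ⊗ K)` over `O = 𝒪_K` under `k < e` (twist exponent
`ν = k/e < 1`). This file removes `k < e`: it suffices that the `[p]`-series of `V''` have a
coefficient `bᵢ`, `i ≥ 2`, and a real radius `ρ₀` with
  `p⁻¹ ≤ ‖bᵢ‖ · ρ₀^{i−1}`  and  `ρ₀ < p · ‖π‖ᵏ`                                             (†)
— i.e. the Newton polygon of `[p](Z)/Z` has a slope, equivalently `V''` a `p`-torsion point `P` in
its formal group, of valuation `v(Z(P)) > ν − 1` (`norm = p^{−v}`). For `k < e` any unit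
coefficient `b_J` gives (†) with `ρ₀ = p^{−1/(J−1)}`; in general (†) is supplied at `p = 2, 3` by
Vieta on `Ψ₂², Ψ₃` on the semistable model together with the Kraus bounds
`12ν = min(v(Δ_min), 3v(c₄)) ≤ 23` (`2`), `≤ 13` (`3`) of `KrausNonMinimalityTwoThreeProofs` — the
case analysis recorded in `NeronIsogenyScaling.lean` ("the undecided class is EMPTY").

* `padicNorm_le_one_of_formalLog_subst_eq_of_semistableTwist_of_slope` — the LOCAL theorem:
  hypotheses of `padicNorm_le_one_of_formalLog_subst_eq_of_semistableTwist` with `k < e` replaced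
  by (†). Proof: Steps 5–9 of that file verbatim (`t₃ ∈ O⟦q⟧` with `t₃ ↦ t''`, `[q¹]t₃ = πᵏu`,
  `u = n₁/d`); then, if `p ∤ d`, `‖u‖_p ≤ 1` outright, and if `d = p·d₂` the series
  `T := [d₂]_{V''}(t₃) ∈ qO⟦q⟧` has `[p]_{V''}(T) = [d](t₃) = [n₁](θ₀(ψ)) ∈ πᵏ·O⟦q⟧` (the twist
  series `θ₀` is `πᵏ·θ₁`), dominated by its linear coefficient `πᵏn₁d·u/d… = πᵏ·(du) = πᵏn₁` of norm
  `‖π‖ᵏ` (`p ∤ n₁`), while `‖T₁‖ = ‖d₂ πᵏ u‖ = p‖π‖ᵏ`; the root form of the sharp lemma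
  (`Literature.RingTheory.PowerSeries.norm_coeff_one_le_of_subst_dominated`, in `ℚ̄_p`) gives
  `‖T₁‖ ≤ ρ₀ < p‖π‖ᵏ` — contradiction.
* `padicNorm_le_one_of_neronLattice_eq_smul_periodLattice_of_semistableTwist_of_slope` and
  `…_of_slope_of_dvd_of_dvd` — the same for the data of the fact (Steps 1–4 of the `k < e` file) and
  at an additive prime with the free Honda witness.

## References

* B. Edixhoven, *On the Manin constants of modular elliptic curves*, in: Arithmetic Algebraic
  Geometry (Texel, 1989), Progr. Math. 89 (1991), 25–39, Prop. 2. [EdixhovenManin1991]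
* T. Honda, *On the theory of commutative formal groups*, J. Math. Soc. Japan 22 (1970), 213–246,
  Thm. 2 (p. 223). [Honda1970]
* H. Pasten, *Shimura curves and the abc conjecture*, J. Number Theory (2024), §10.1 (p. 33).
  [PastenShimura2024]
* J. H. Silverman, *The Arithmetic of Elliptic Curves*, 2nd ed. (2009), III.1, IV.1, IV.2.3, VII.1.
  [SilvermanAEC2009]
-/

noncomputable section

open scoped Classical IntermediateField

namespace WeierstrassCurve

open PowerSeries Literature.NumberTheory.EllipticCurves Literature.RingTheory.FormalGroups

section IntegralTheta

variable {O K : Type*} [CommRing O] [CommRing K] [Algebra O K]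

/-- **The twist isomorphism is integral and divisible by `u`.** As
`exists_map_eq_formalVariableChange`, exporting the factorisation `θ₀ = u · θ₁`,
`θ₁ = (X − r w)/(1 + sX + (t − sr)w) ∈ XO⟦X⟧`, `[X¹]θ₁ = 1`. [cite: SilvermanAEC2009, III.1 and IV.1] -/
theorem exists_map_eq_formalVariableChange_factor (V : WeierstrassCurve O) (C' : VariableChange K)
    (u r s t : O) (hu : (C'.u : K) = algebraMap O K u) (hr : C'.r = algebraMap O K r)
    (hs : C'.s = algebraMap O K s) (ht : C'.t = algebraMap O K t) :
    ∃ θ₀ θ₁ : O⟦X⟧, θ₀.map (algebraMap O K) = (V.map (algebraMap O K)).formalVariableChange C' ∧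
      constantCoeff θ₀ = 0 ∧ coeff 1 θ₀ = u ∧ θ₀ = PowerSeries.C u * θ₁ := by
  set W := V.map (algebraMap O K) with hW
  set den₀ : O⟦X⟧ := 1 + PowerSeries.C s * X + PowerSeries.C (t - s * r) * V.formalW with hden₀
  set θ₁ : O⟦X⟧ := (X - PowerSeries.C r * V.formalW) * invOfUnit den₀ 1 with hθ₁
  set θ₀ : O⟦X⟧ := PowerSeries.C u * (X - PowerSeries.C r * V.formalW) * invOfUnit den₀ 1 with hθ₀
  have hden₀c : constantCoeff den₀ = 1 := by simp [hden₀, V.constantCoeff_formalW]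
  have hden₀inv : den₀ * invOfUnit den₀ 1 = 1 := mul_invOfUnit den₀ 1 (by rw [hden₀c, Units.val_one])
  have hmapden : den₀.map (algebraMap O K) = W.formalVariableChangeDenom C' := by
    rw [hden₀, formalVariableChangeDenom, hW, ← map_formalW]
    simp only [map_add, map_mul, map_one, map_C, map_X, map_sub, hs, ht, hr]
  refine ⟨θ₀, θ₁, ?_, ?_, ?_, ?_⟩
  · -- both are `u(X − r w)/den`
    apply (W.isUnit_formalVariableChangeDenom C').mul_left_injective
    change θ₀.map (algebraMap O K) * W.formalVariableChangeDenom C' =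
      W.formalVariableChange C' * W.formalVariableChangeDenom C'
    rw [formalVariableChange_mul_denom, ← hmapden, ← map_mul, hθ₀, mul_assoc,
      mul_comm (invOfUnit _ _), hden₀inv, mul_one, hW, ← map_formalW]
    simp only [map_mul, map_sub, map_C, map_X, hu, hr]
  · simp [hθ₀, V.constantCoeff_formalW]
  · have hw1 : coeff 1 V.formalW = 0 := V.coeff_formalW_of_lt_three (by norm_num)
    have hw0 : constantCoeff V.formalW = 0 := V.constantCoeff_formalW
    rw [hθ₀, PowerSeries.coeff_one_mul, PowerSeries.coeff_one_mul]
    simp [hw0, hw1, coeff_one_X, constantCoeff_invOfUnit]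
  · rw [hθ₀, hθ₁, mul_assoc]

end IntegralTheta

section SubstDivisible

variable {O : Type*} [CommRing O]

/-- **`F(c·Y)` is divisible by `c` when `F(0) = 0`**: for `F ∈ XO⟦X⟧` and `Y ∈ XO⟦X⟧`,
`F(C c · Y) = C c · S'` for some `S'`. [folklore] -/
theorem exists_subst_C_mul_eq (F Y : O⟦X⟧) (hF : constantCoeff F = 0) (hY : constantCoeff Y = 0)
    (c : O) : ∃ S' : O⟦X⟧, F.subst (PowerSeries.C c * Y) = PowerSeries.C c * S' := by
  obtain ⟨F₁, hF₁⟩ := X_dvd_iff.mpr hF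
  have hZ0 : constantCoeff (PowerSeries.C c * Y) = 0 := by rw [map_mul, hY, mul_zero]
  have hZs : HasSubst (PowerSeries.C c * Y) := HasSubst.of_constantCoeff_zero' hZ0
  refine ⟨Y * F₁.subst (PowerSeries.C c * Y), ?_⟩
  rw [hF₁, ← coe_substAlgHom hZs, map_mul, coe_substAlgHom, subst_X hZs]
  ring

end SubstDivisible

end WeierstrassCurve

/-! ### The theorem -/

namespace Literature.NumberTheory.EllipticCurves

open PowerSeries Literature.RingTheory.FormalGroups Literature.NumberTheory.EllipticCurves.ModularForms
open Literature.NumberTheory.EllipticCurves.HondaCongruence Literature.NumberTheory.Automorphic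
open Literature.NumberTheory.GaloisRepresentations
open _root_.WeierstrassCurve
open scoped MatrixGroups ModularForm
open CongruenceSubgroup IsLocalRing

set_option maxHeartbeats 4000000 in
/-- **The local step, model-free, over a finite extension, WITHOUT `k < e`.** Hypotheses of
`padicNorm_le_one_of_formalLog_subst_eq_of_semistableTwist` (`W'/ℚ` globally minimal; `t₀` with
`log_{W'}(t₀) = u·Σaₙ Xⁿ/n`, `[X¹]t₀ = u > 0`, `t₀, w(t₀) ∈ Frac ℤ⟦X⟧`; a Honda witness `ψ`;
`K/ℚ_p` finite, `‖π‖ᵉ = p⁻¹`, `r, s, t ∈ O`, `V''/O` with `V'' ⊗ K = (πᵏ, r, s, t) • (W' ⊗ K)` of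
finite height), with `k < e` replaced by a SLOPE of `[p]_{V''}` beyond `ν − 1`: some `i ≥ 2` and
`0 ≤ ρ₀ < p‖π‖ᵏ` with `p⁻¹ ≤ ‖bᵢ‖ρ₀^{i−1}`, `bᵢ = [Zⁱ][p]_{V''}` (e.g. `ρ₀ = ‖Z(P)‖` for a `p`-torsion
point `P` of `V''` in the formal group with `v(Z(P)) > ν − 1`). Then `‖u‖_p ≤ 1`.
[cite: Honda1970, Thm. 2 (p. 223)] [cite: EdixhovenManin1991, Prop. 2] -/
theorem padicNorm_le_one_of_formalLog_subst_eq_of_semistableTwist_of_slope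
    (W' : WeierstrassCurve ℚ) [W'.IsElliptic] [W'.IsGloballyMinimal] {p : ℕ} [Fact p.Prime]
    {u : ℚ} (hCpos : 0 < u) {t₀ : ℚ⟦X⟧} (ht₀0 : constantCoeff t₀ = 0) (ht₀1 : coeff 1 t₀ = u)
    (hlog₀ : W'.formalLog.subst t₀ = C u * PowerSeries.mk fun n ↦ ((W'.LFunction n : ℤ) : ℚ) / n)
    {P' Q' P₂' Q₂' : ℤ⟦X⟧} (hQ' : Q' ≠ 0)
    (hPQ' : t₀ * Q'.map (Int.castRingHom ℚ) = P'.map (Int.castRingHom ℚ)) (hQ₂' : Q₂' ≠ 0)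
    (hPQ₂' : W'.formalW.subst t₀ * Q₂'.map (Int.castRingHom ℚ) = P₂'.map (Int.castRingHom ℚ))
    (hψex : ∃ ψ : ℚ_[p]⟦X⟧, constantCoeff ψ = 0 ∧ (∀ n, ‖coeff n ψ‖ ≤ 1) ∧
      (W'.map (algebraMap ℚ ℚ_[p])).formalLog.subst ψ =
        PowerSeries.mk fun k ↦ ((W'.LFunction k : ℤ) : ℚ_[p]) / k)
    (K : IntermediateField ℚ_[p] (PadicAlgCl p)) [FiniteDimensional ℚ_[p] K]
    (πu : Kˣ) {e k : ℕ} (hπe : ‖((πu : K) : PadicAlgCl p)‖ ^ e = (p : ℝ)⁻¹)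
    (r s t : padicCoeffRing K) (V'' : WeierstrassCurve (padicCoeffRing K))
    (hV'' : V''.map (algebraMap (padicCoeffRing K) K) =
      (⟨πu ^ k, (r : K), (s : K), (t : K)⟩ : VariableChange K) • W'.map (algebraMap ℚ K))
    (hfin : ∃ J : ℕ, 0 < J ∧ IsUnit (coeff J (V''.formalMul p)))
    (hslope : ∃ (i : ℕ) (ρ₀ : ℝ), 2 ≤ i ∧ 0 ≤ ρ₀ ∧ ρ₀ < p * ‖((πu : K) : PadicAlgCl p)‖ ^ k ∧
      (p : ℝ)⁻¹ ≤ ‖(((coeff i (V''.formalMul p) : padicCoeffRing K) : K) : PadicAlgCl p)‖ * ρ₀ ^ (i - 1)) :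
    ‖((u : ℚ) : ℚ_[p])‖ ≤ 1 := by
  have ht₀s : HasSubst t₀ := HasSubst.of_constantCoeff_zero' ht₀0
  /- Step 5: the ring `(padicCoeffRing K) = 𝒪_K` (a complete DVR), `π`, and the maps. -/
  letI hOloc : IsLocalRing (padicCoeffRing K) := isLocalRing_padicCoeffRing K
  haveI hOpid : IsPrincipalIdealRing (padicCoeffRing K) := isPrincipalIdealRing_padicCoeffRing K
  haveI hOcpl : IsAdicComplete (maximalIdeal (padicCoeffRing K)) (padicCoeffRing K) := isAdicComplete_padicCoeffRing K
  letI hOch : CharP (ResidueField (padicCoeffRing K)) p := charP_residueField_padicCoeffRing K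
  have hp1R : (1 : ℝ) < p := by exact_mod_cast (Fact.out : p.Prime).one_lt
  set π : PadicAlgCl p := ((πu : K) : PadicAlgCl p) with hπdef
  have he0 : e ≠ 0 := by
    rintro rfl
    rw [pow_zero] at hπe
    exact absurd hπe.symm (ne_of_lt (inv_lt_one_of_one_lt₀ hp1R))
  have hπle : ‖π‖ ≤ 1 := by
    by_contra hcon
    rw [not_le] at hcon
    have h1 : (1 : ℝ) < ‖π‖ ^ e := one_lt_pow₀ hcon he0
    rw [hπe] at h1
    exact absurd h1 (not_lt.mpr (inv_le_one_of_one_le₀ hp1R.le))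
  have hπlt : ‖π‖ < 1 := by
    by_contra hcon
    rw [not_lt] at hcon
    have h1 : (1 : ℝ) ≤ ‖π‖ ^ e := one_le_pow₀ hcon
    rw [hπe] at h1
    exact absurd h1 (not_le.mpr (inv_lt_one_of_one_lt₀ hp1R))
  set πO : (padicCoeffRing K) := ⟨(πu : K), (mem_padicCoeffRing_iff K _).mpr hπle⟩ with hπOdef
  have hπOc : ((πO : (padicCoeffRing K)) : K) = (πu : K) := rfl
  have hπOmax : πO ∈ maximalIdeal (padicCoeffRing K) := by
    rw [mem_maximalIdeal_padicCoeffRing_iff, hπOc]; exact hπlt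
  set ι : ℤ_[p] →+* (padicCoeffRing K) := padicIntToCoeffRing K with hιdef
  set φK : ℚ_[p] →+* K := algebraMap ℚ_[p] K with hφK
  set φ : ℚ →+* ℚ_[p] := algebraMap ℚ ℚ_[p] with hφ
  set φQ : ℚ →+* K := algebraMap ℚ K with hφQ
  have halgO : ∀ y : (padicCoeffRing K), algebraMap (padicCoeffRing K) K y = (y : K) := fun y ↦ rfl
  have hinjO : Function.Injective (algebraMap (padicCoeffRing K) K) := fun x y h ↦ Subtype.ext h
  have hιφ : ∀ x : ℤ_[p], algebraMap (padicCoeffRing K) K (ι x) = φK (x : ℚ_[p]) := fun x ↦ rfl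
  have hcomp : φK.comp φ = φQ := RingHom.ext fun x ↦ by
    rw [eq_ratCast (φK.comp φ) x, eq_ratCast φQ x]
  have hmm : ∀ R : ℤ_[p]⟦X⟧, (R.map ι).map (algebraMap (padicCoeffRing K) K) =
      (R.map (algebraMap ℤ_[p] ℚ_[p])).map φK := fun R ↦ by
    ext n
    simp only [coeff_map, hιφ]
    rfl
  have hintQ : ∀ R : ℤ⟦X⟧, ((R.map (Int.castRingHom ℤ_[p])).map ι).map (algebraMap (padicCoeffRing K) K) =
      (R.map (Int.castRingHom ℚ)).map φQ := fun R ↦ by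
    ext n
    simp [coeff_map]
  /- Step 6: the curves over `K`: `WK = W' ⊗ K = VO ⊗ K`, the twist `W'' = C'' • WK = V'' ⊗ K`,
  the integral isomorphism `θ`, and the series `t''`, its logarithm, its `Frac (padicCoeffRing K)⟦X⟧`-witness. -/
  set WK : WeierstrassCurve K := W'.map φQ with hWK
  set VO : WeierstrassCurve (padicCoeffRing K) := (integralModelInt W').map (Int.castRingHom (padicCoeffRing K)) with hVO
  have hVOK : VO.map (algebraMap (padicCoeffRing K) K) = WK := by
    have h1 : ((integralModelInt W').map (Int.castRingHom ℚ)).map φQ = W'.map φQ := by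
      rw [map_integralModelInt]
    rw [map_map] at h1
    rw [hVO, map_map, hWK]
    exact (congrArg (integralModelInt W').map (RingHom.ext_int _ _)).trans h1
  set C'' : VariableChange K := ⟨πu ^ k, (r : K), (s : K), (t : K)⟩ with hC''
  set W'' : WeierstrassCurve K := C'' • WK with hW''
  have hV''K : V''.map (algebraMap (padicCoeffRing K) K) = W'' := by rw [hW'', hC'', hWK, hV'']
  obtain ⟨θ₀, θ₁, hθ₀, hθ₀0, hθ₀1, hθ₀fac⟩ := VO.exists_map_eq_formalVariableChange_factor C'' (πO ^ k) r s t
    (by rw [hC'', Units.val_pow_eq_pow_val, map_pow, halgO, hπOc]) rfl rfl rfl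
  rw [hVOK] at hθ₀
  set θ := WK.formalVariableChange C'' with hθ
  have hθ0 : constantCoeff θ = 0 := WK.constantCoeff_formalVariableChange C''
  have hθs : HasSubst θ := HasSubst.of_constantCoeff_zero' hθ0
  have hθ₀s : HasSubst θ₀ := HasSubst.of_constantCoeff_zero' hθ₀0
  -- `t₀` over `K` and `t'' = θ(t₀)`
  set t₀K : K⟦X⟧ := t₀.map φQ with ht₀K
  have ht₀K0 : constantCoeff t₀K = 0 := by
    rw [ht₀K, ← coeff_zero_eq_constantCoeff, coeff_map, coeff_zero_eq_constantCoeff, ht₀0, map_zero]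
  have ht₀Ks : HasSubst t₀K := HasSubst.of_constantCoeff_zero' ht₀K0
  have ht₀K1 : coeff 1 t₀K = φQ u := by rw [ht₀K, coeff_map, ht₀1]
  set ℓK : K⟦X⟧ := PowerSeries.mk fun k ↦ ((W'.LFunction k : ℤ) : K) / k with hℓK
  have hℓ' : (PowerSeries.mk fun n ↦ ((W'.LFunction n : ℤ) : ℚ) / n).map φQ = ℓK := by
    ext n; rw [coeff_map, coeff_mk, hℓK, coeff_mk, map_div₀, map_natCast, map_intCast]
  have hlogK : WK.formalLog.subst t₀K = C (φQ u) * ℓK := by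
    rw [ht₀K, hWK, ← W'.map_formalLog φQ, ← powerSeries_map_subst ht₀s φQ, hlog₀, map_mul, map_C, hℓ']
  set t'' : K⟦X⟧ := θ.subst t₀K with ht''
  have ht''0 : constantCoeff t'' = 0 := (constantCoeff_subst_eq_constantCoeff ht₀K0).trans hθ0
  have ht''s : HasSubst t'' := HasSubst.of_constantCoeff_zero' ht''0
  have ht''1 : coeff 1 t'' = (πu : K) ^ k * φQ u := by
    rw [ht'', hθ, WK.coeff_one_formalVariableChange_subst C'' ht₀K0, ht₀K1, hC'', Units.val_pow_eq_pow_val]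
  have hlog'' : W''.formalLog.subst t'' = C ((πu : K) ^ k) * (C (φQ u) * ℓK) := by
    rw [ht'', hW'', hθ, WK.formalLog_subst_formalVariableChange_subst C'' ht₀K0, hlogK, hC'',
      Units.val_pow_eq_pow_val]
  -- the `Frac (padicCoeffRing K)⟦X⟧`-witness for `t''`: `t''·(Q'Q₂' + sP'Q₂' + (t − sr)Q'P₂') = πᵏ(P'Q₂' − rQ'P₂')`
  have hwK : WK.formalW.subst t₀K = PowerSeries.map φQ (W'.formalW.subst t₀) := by
    rw [ht₀K, hWK, ← map_formalW, powerSeries_map_subst ht₀s φQ]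
  have keyK := WK.subst_formalVariableChange_mul_denom C'' ht₀K0
  rw [← hθ, ← ht'', hwK] at keyK
  set iO : ℤ⟦X⟧ → (padicCoeffRing K)⟦X⟧ := fun R ↦ (R.map (Int.castRingHom ℤ_[p])).map ι with hiO
  set Q'' : (padicCoeffRing K)⟦X⟧ := iO Q' * iO Q₂' + C s * iO P' * iO Q₂' + C (t - s * r) * iO Q' * iO P₂' with hQ''
  set P'' : (padicCoeffRing K)⟦X⟧ := C (πO ^ k) * (iO P' * iO Q₂' - C r * iO Q' * iO P₂') with hP''
  have hmapP' : (iO P').map (algebraMap (padicCoeffRing K) K) = (P'.map (Int.castRingHom ℚ)).map φQ := hintQ P'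
  have hmapQ' : (iO Q').map (algebraMap (padicCoeffRing K) K) = (Q'.map (Int.castRingHom ℚ)).map φQ := hintQ Q'
  have hmapP₂' : (iO P₂').map (algebraMap (padicCoeffRing K) K) = (P₂'.map (Int.castRingHom ℚ)).map φQ := hintQ P₂'
  have hmapQ₂' : (iO Q₂').map (algebraMap (padicCoeffRing K) K) = (Q₂'.map (Int.castRingHom ℚ)).map φQ := hintQ Q₂'
  have hPQ'K : t₀K * (Q'.map (Int.castRingHom ℚ)).map φQ = (P'.map (Int.castRingHom ℚ)).map φQ := by
    rw [ht₀K, ← map_mul, hPQ']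
  have hPQ₂'K : PowerSeries.map φQ (W'.formalW.subst t₀) * (Q₂'.map (Int.castRingHom ℚ)).map φQ =
      (P₂'.map (Int.castRingHom ℚ)).map φQ := by
    rw [← map_mul, hPQ₂']
  have hCs : (C s : (padicCoeffRing K)⟦X⟧).map (algebraMap (padicCoeffRing K) K) = C C''.s := by rw [map_C, halgO, hC'']
  have hCr : (C r : (padicCoeffRing K)⟦X⟧).map (algebraMap (padicCoeffRing K) K) = C C''.r := by rw [map_C, halgO, hC'']
  have hCtsr : (C (t - s * r) : (padicCoeffRing K)⟦X⟧).map (algebraMap (padicCoeffRing K) K) = C (C''.t - C''.s * C''.r) := by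
    rw [map_C, map_sub, map_mul, halgO, halgO, halgO, hC'']
  have hCπ : (C (πO ^ k) : (padicCoeffRing K)⟦X⟧).map (algebraMap (padicCoeffRing K) K) = C ((C''.u : Kˣ) : K) := by
    rw [map_C, map_pow, halgO, hπOc, hC'', Units.val_pow_eq_pow_val]
  have hQ''K : Q''.map (algebraMap (padicCoeffRing K) K) =
      (Q'.map (Int.castRingHom ℚ)).map φQ * (Q₂'.map (Int.castRingHom ℚ)).map φQ *
        (1 + C C''.s * t₀K + C (C''.t - C''.s * C''.r) * PowerSeries.map φQ (W'.formalW.subst t₀)) := by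
    rw [hQ'']
    simp only [map_add, map_mul, hmapP', hmapQ', hmapP₂', hmapQ₂', hCs, hCtsr]
    linear_combination (C C''.s * (Q₂'.map (Int.castRingHom ℚ)).map φQ) * hPQ'K.symm +
      (C (C''.t - C''.s * C''.r) * (Q'.map (Int.castRingHom ℚ)).map φQ) * hPQ₂'K.symm
  have hP''K : P''.map (algebraMap (padicCoeffRing K) K) =
      C ((C''.u : Kˣ) : K) * ((P'.map (Int.castRingHom ℚ)).map φQ * (Q₂'.map (Int.castRingHom ℚ)).map φQ -
        C C''.r * (Q'.map (Int.castRingHom ℚ)).map φQ * (P₂'.map (Int.castRingHom ℚ)).map φQ) := by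
    rw [hP'']
    simp only [map_mul, map_sub, hmapP', hmapQ', hmapP₂', hmapQ₂', hCr, hCπ]
  have hQ''0 : Q'' ≠ 0 := by
    intro h0
    have h0' := congrArg (PowerSeries.map (algebraMap (padicCoeffRing K) K)) h0
    rw [map_zero, hQ''K] at h0'
    have hQ'0 : (Q'.map (Int.castRingHom ℚ)).map φQ ≠ 0 := by
      intro h
      apply hQ'
      apply PowerSeries.map_injective (Int.castRingHom ℚ) Int.cast_injective
      apply PowerSeries.map_injective φQ φQ.injective
      rw [h, map_zero, map_zero]
    have hQ₂'0 : (Q₂'.map (Int.castRingHom ℚ)).map φQ ≠ 0 := by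
      intro h
      apply hQ₂'
      apply PowerSeries.map_injective (Int.castRingHom ℚ) Int.cast_injective
      apply PowerSeries.map_injective φQ φQ.injective
      rw [h, map_zero, map_zero]
    have hden0 : (1 + C C''.s * t₀K + C (C''.t - C''.s * C''.r) * PowerSeries.map φQ (W'.formalW.subst t₀)) ≠ 0 := by
      intro h
      have h1 := congrArg constantCoeff h
      have hw0 : constantCoeff (PowerSeries.map φQ (W'.formalW.subst t₀)) = 0 := by
        rw [← coeff_zero_eq_constantCoeff, coeff_map, coeff_zero_eq_constantCoeff,
          constantCoeff_subst_eq_constantCoeff ht₀0, W'.constantCoeff_formalW, map_zero]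
      rw [map_add, map_add, map_mul, map_mul, ht₀K0, hw0] at h1
      simp at h1
    exact (mul_ne_zero (mul_ne_zero hQ'0 hQ₂'0) hden0) h0'
  have hPQ'' : t'' * Q''.map (algebraMap (padicCoeffRing K) K) = P''.map (algebraMap (padicCoeffRing K) K) := by
    rw [hQ''K, hP''K]
    linear_combination ((Q'.map (Int.castRingHom ℚ)).map φQ * (Q₂'.map (Int.castRingHom ℚ)).map φQ) * keyK +
      (C ((C''.u : Kˣ) : K) * (Q₂'.map (Int.castRingHom ℚ)).map φQ) * hPQ'K -
      (C ((C''.u : Kˣ) : K) * C C''.r * (Q'.map (Int.castRingHom ℚ)).map φQ) * hPQ₂'K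
  /- Step 7: the Honda witness over `K` and `(padicCoeffRing K)`; `u = n₁ / d`; `[d]_{W''}(t'') = [n₁]_{W''}(x)`,
  `x = θ(ψ)`, an `(padicCoeffRing K)`-integral series. -/
  obtain ⟨ψ, hψ0, hψi, hψ⟩ := hψex
  have hψs : HasSubst ψ := HasSubst.of_constantCoeff_zero' hψ0
  obtain ⟨ψ₁, hψ₁⟩ := isPadicInt_iff_exists_powerSeries_map.mp (isPadicInt_iff_coeff.mpr hψi)
  set ψK : K⟦X⟧ := ψ.map φK with hψK
  have hψK0 : constantCoeff ψK = 0 := by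
    rw [hψK, ← coeff_zero_eq_constantCoeff, coeff_map, coeff_zero_eq_constantCoeff, hψ0, map_zero]
  have hψKs : HasSubst ψK := HasSubst.of_constantCoeff_zero' hψK0
  have hψOK : (ψ₁.map ι).map (algebraMap (padicCoeffRing K) K) = ψK := by
    rw [hmm]; exact congrArg (PowerSeries.map φK) hψ₁
  have hWKp : (W'.map φ).map φK = WK := by rw [hWK, map_map, hcomp]
  have hℓ'' : (PowerSeries.mk fun n ↦ ((W'.LFunction n : ℤ) : ℚ_[p]) / n).map φK = ℓK := by
    ext n; rw [coeff_map, coeff_mk, hℓK, coeff_mk, map_div₀, map_natCast, map_intCast]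
  have hlogψK : WK.formalLog.subst ψK = ℓK := by
    rw [hψK, ← hWKp, ← (W'.map φ).map_formalLog φK, ← powerSeries_map_subst hψs φK, hψ, hℓ'']
  set x : K⟦X⟧ := θ.subst ψK with hx
  have hx0 : constantCoeff x = 0 := (constantCoeff_subst_eq_constantCoeff hψK0).trans hθ0
  have hxs : HasSubst x := HasSubst.of_constantCoeff_zero' hx0
  have hxO : PowerSeries.map (algebraMap (padicCoeffRing K) K) (θ₀.subst (ψ₁.map ι)) = x := by
    rw [powerSeries_map_subst (HasSubst.of_constantCoeff_zero' (by
      rw [← coeff_zero_eq_constantCoeff, coeff_map, coeff_zero_eq_constantCoeff]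
      have h := hψ0
      rw [← hψ₁, ← coeff_zero_eq_constantCoeff, coeff_map, coeff_zero_eq_constantCoeff] at h
      rw [PadicInt.coe_eq_zero.mp h, map_zero])) (algebraMap (padicCoeffRing K) K), hθ₀, hψOK, hx, hθ]
  have hlogx : W''.formalLog.subst x = C ((πu : K) ^ k) * ℓK := by
    rw [hx, hW'', hθ, WK.formalLog_subst_formalVariableChange_subst C'' hψK0, hlogψK, hC'',
      Units.val_pow_eq_pow_val]
  -- `u = n₁ / d`
  set d : ℕ := u.den with hd
  have hd0 : 0 < d := u.den_pos
  have hnum : 0 < u.num := Rat.num_pos.mpr hCpos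
  set n₁ : ℕ := u.num.toNat with hn₁
  have hn₁z : ((n₁ : ℕ) : ℤ) = u.num := Int.toNat_of_nonneg hnum.le
  have hdu : (d : K) * φQ u = (n₁ : K) := by
    have h : (u) * d = (u.num : ℚ) := Rat.mul_den_eq_num _
    rw [← hn₁z] at h
    have h' := congrArg φQ h
    rw [map_mul, map_natCast, Int.cast_natCast, map_natCast] at h'
    rw [mul_comm]
    exact h'
  set wK : K⟦X⟧ := (W''.formalMul n₁).subst x with hwK'
  have hwK0 : constantCoeff wK = 0 :=
    (constantCoeff_subst_eq_constantCoeff hx0).trans (W''.constantCoeff_formalMul n₁)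
  have hlogw : W''.formalLog.subst wK = n₁ • (C ((πu : K) ^ k) * ℓK) := by
    rw [hwK', ← subst_comp_subst_apply (W''.hasSubst_formalMul n₁) hxs, W''.formalLog_subst_formalMul_rat n₁,
      ← coe_substAlgHom hxs, map_nsmul, coe_substAlgHom, hlogx]
  have hdt''0 : constantCoeff ((W''.formalMul d).subst t'') = 0 :=
    (constantCoeff_subst_eq_constantCoeff ht''0).trans (W''.constantCoeff_formalMul d)
  have hlogd : W''.formalLog.subst ((W''.formalMul d).subst t'') = n₁ • (C ((πu : K) ^ k) * ℓK) := by
    rw [← subst_comp_subst_apply (W''.hasSubst_formalMul d) ht''s, W''.formalLog_subst_formalMul_rat d,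
      ← coe_substAlgHom ht''s, map_nsmul, coe_substAlgHom, hlog'', nsmul_eq_mul, nsmul_eq_mul,
      ← map_natCast (C : K →+* K⟦X⟧) d, ← map_natCast (C : K →+* K⟦X⟧) n₁, ← hdu, map_mul]
    ring
  have hGw : (W''.formalMul d).subst t'' = wK :=
    W''.eq_of_formalLog_subst_eq hdt''0 hwK0 (hlogd.trans hlogw.symm)
  -- `[d]_{V''}(t'') = w''`, `w'' = [n₁]_{V''}(θ₀(ψ)) ∈ (padicCoeffRing K)⟦X⟧`
  set w'' : (padicCoeffRing K)⟦X⟧ := (V''.formalMul n₁).subst (θ₀.subst (ψ₁.map ι)) with hw''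
  have hψ₁ιs : HasSubst (θ₀.subst (ψ₁.map ι)) := by
    refine HasSubst.of_constantCoeff_zero' ((constantCoeff_subst_eq_constantCoeff ?_).trans hθ₀0)
    rw [← coeff_zero_eq_constantCoeff, coeff_map, coeff_zero_eq_constantCoeff]
    have h := hψ0
    rw [← hψ₁, ← coeff_zero_eq_constantCoeff, coeff_map, coeff_zero_eq_constantCoeff] at h
    rw [PadicInt.coe_eq_zero.mp h, map_zero]
  have hGz : (V''.formalMul d).subst t'' = w''.map (algebraMap (padicCoeffRing K) K) := by
    rw [← subst_map_algebraMap (V''.formalMul d) ht''s, map_formalMul, hV''K, hGw, hw'',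
      powerSeries_map_subst hψ₁ιs (algebraMap (padicCoeffRing K) K), map_formalMul, hV''K, hxO]
  /- Step 8: finite height of `V'' ⊗ k_K`: a unit coefficient of `[d]_{V''}` in positive degree. -/
  obtain ⟨nn, hnn, hunit⟩ : ∃ nn : ℕ, 0 < nn ∧ IsUnit (coeff nn (V''.formalMul d)) := by
    obtain ⟨J, hJ, hJu⟩ := hfin
    have hP : (V''.map (residue (padicCoeffRing K))).formalMul p ≠ 0 := by
      rw [← map_formalMul]
      intro h0'
      have h := congrArg (coeff J) h0'
      rw [coeff_map, map_zero] at h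
      exact (residue_ne_zero_iff_isUnit _ |>.mpr hJu) h
    have hD : (V''.map (residue (padicCoeffRing K))).formalMul d ≠ 0 :=
      (V''.map (residue (padicCoeffRing K))).formalMul_ne_zero_of_formalMul_prime_ne_zero hP hd0
    obtain ⟨nn, hnn⟩ := exists_coeff_ne_zero_iff_ne_zero.mpr hD
    rw [← map_formalMul, coeff_map] at hnn
    refine ⟨nn, Nat.pos_of_ne_zero ?_, ?_⟩
    · rintro rfl
      apply hnn
      rw [coeff_zero_eq_constantCoeff_apply, V''.constantCoeff_formalMul d, map_zero]
    · by_contra hu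
      apply hnn
      exact (residue_eq_zero_iff _).mpr ((IsLocalRing.mem_maximalIdeal _).mpr hu)
  /- Step 9: the local lemma over `(padicCoeffRing K)`, and `‖u‖ ≤ 1`. -/
  obtain ⟨t₃, ht₃⟩ := Literature.RingTheory.PowerSeries.exists_map_eq_of_subst_eq_map (O := padicCoeffRing K) (L := K)
    hinjO hnn hunit ht''0 hGz hQ''0 hPQ''
  /- Step 10 (this file): `u = n₁/d`; if `p ∤ d` then `‖u‖ ≤ 1`; if `d = p·d₂`, the sharp lemma. -/
  by_cases hpd : p ∣ d
  swap
  · exact Padic.norm_rat_le_one hpd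
  exfalso
  obtain ⟨d₂, hd₂⟩ := hpd
  obtain ⟨i, ρ₀, hi, hρ₀, hρ₀lt, hsl⟩ := hslope
  -- `t₃ ∈ XO⟦X⟧`, `[X¹]t₃ ↦ πᵏ u`
  have h1 : algebraMap (padicCoeffRing K) K (coeff 1 t₃) = (πu : K) ^ k * φQ u := by
    rw [← ht''1, ← ht₃, coeff_map]
  have ht₃0 : constantCoeff t₃ = 0 := by
    apply hinjO
    rw [map_zero, ← coeff_zero_eq_constantCoeff, ← coeff_map, ht₃, coeff_zero_eq_constantCoeff, ht''0]
  have ht₃s : HasSubst t₃ := HasSubst.of_constantCoeff_zero' ht₃0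
  -- `S := [d](t₃) = w'' = [n₁](θ₀(ψ))` as `O`-series
  set S : (padicCoeffRing K)⟦X⟧ := (V''.formalMul d).subst t₃ with hSdef
  have hSw : S = w'' := by
    apply PowerSeries.map_injective (algebraMap (padicCoeffRing K) K) hinjO
    rw [hSdef, powerSeries_map_subst ht₃s (algebraMap (padicCoeffRing K) K), ht₃,
      subst_map_algebraMap _ ht''s, hGz]
  -- `S = πᵏ · S'`
  have hψO0 : constantCoeff (ψ₁.map ι) = 0 := by
    rw [← coeff_zero_eq_constantCoeff, coeff_map, coeff_zero_eq_constantCoeff]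
    have h := hψ0
    rw [← hψ₁, ← coeff_zero_eq_constantCoeff, coeff_map, coeff_zero_eq_constantCoeff] at h
    rw [PadicInt.coe_eq_zero.mp h, map_zero]
  have hψOs : HasSubst (ψ₁.map ι) := HasSubst.of_constantCoeff_zero' hψO0
  have hY0 : constantCoeff (θ₁.subst (ψ₁.map ι)) = 0 := by
    rw [constantCoeff_subst_eq_constantCoeff hψO0]
    have h := hθ₀0
    rw [hθ₀fac, map_mul] at h
    -- `constantCoeff (C c) * constantCoeff θ₁ = 0`; but we only need `constantCoeff θ₁ = 0`:
    -- from `θ₁ = (X − r w)·inv`, directly: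
    have : constantCoeff θ₀ = (πO ^ k) * constantCoeff θ₁ := by
      rw [hθ₀fac, map_mul, constantCoeff_C]
    rw [hθ₀0] at this
    -- `πᵏ ≠ 0` in the domain `O`
    have hπk0 : (πO ^ k : padicCoeffRing K) ≠ 0 := by
      apply pow_ne_zero
      intro h0
      have : ((πO : padicCoeffRing K) : K) = 0 := by rw [h0]; rfl
      rw [hπOc] at this
      exact πu.ne_zero this
    exact (mul_eq_zero.mp this.symm).resolve_left hπk0
  have hθ₀ψ : θ₀.subst (ψ₁.map ι) = PowerSeries.C (πO ^ k) * θ₁.subst (ψ₁.map ι) := by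
    rw [hθ₀fac, ← coe_substAlgHom hψOs, map_mul]
    simp only [coe_substAlgHom]
    congr 1
    exact (subst_C _).trans rfl
  obtain ⟨S', hS'⟩ := WeierstrassCurve.exists_subst_C_mul_eq (V''.formalMul n₁) (θ₁.subst (ψ₁.map ι))
    (V''.constantCoeff_formalMul n₁) hY0 (πO ^ k)
  have hSfac : S = PowerSeries.C (πO ^ k) * S' := by rw [hSw, hw'', hθ₀ψ, hS']
  -- `T := [d₂](t₃)`, `[p](T) = [d](t₃) = S`
  set T : (padicCoeffRing K)⟦X⟧ := (V''.formalMul d₂).subst t₃ with hTdef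
  have hT0 : constantCoeff T = 0 :=
    (constantCoeff_subst_eq_constantCoeff ht₃0).trans (V''.constantCoeff_formalMul d₂)
  have hTs : HasSubst T := HasSubst.of_constantCoeff_zero' hT0
  have hpT : (V''.formalMul p).subst T = S := by
    rw [hTdef, ← subst_comp_subst_apply (V''.hasSubst_formalMul d₂) ht₃s, V''.formalMul_mul_subst' p d₂,
      hSdef, hd₂]
  have hT1 : coeff 1 T = (d₂ : padicCoeffRing K) * coeff 1 t₃ := by
    rw [hTdef, coeff_one_subst_eq_mul _ ht₃0, coeff_one_formalMul']
  -- pass to `ℚ̄_p`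
  set jO : padicCoeffRing K →+* PadicAlgCl p := padicCoeffRingToPadicAlgCl K with hjO
  have hjO : ∀ y : padicCoeffRing K, jO y = ((y : K) : PadicAlgCl p) := fun y ↦ rfl
  have hjOle : ∀ y : padicCoeffRing K, ‖jO y‖ ≤ 1 := fun y ↦ by
    rw [hjO]; exact norm_coe_padicCoeffRing_le K y
  set G : (PadicAlgCl p)⟦X⟧ := (V''.formalMul p).map jO with hGdef
  set T' : (PadicAlgCl p)⟦X⟧ := T.map jO with hT'def
  have hT'0 : constantCoeff T' = 0 := by
    rw [hT'def, ← coeff_zero_eq_constantCoeff, coeff_map, coeff_zero_eq_constantCoeff, hT0, map_zero]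
  have hG0 : constantCoeff G = 0 := by
    rw [hGdef, ← coeff_zero_eq_constantCoeff, coeff_map, coeff_zero_eq_constantCoeff,
      V''.constantCoeff_formalMul p, map_zero]
  have hGT : G.subst T' = S.map jO := by
    rw [hGdef, hT'def, ← powerSeries_map_subst hTs jO, hpT]
  have hGle : ∀ j, ‖coeff j G‖ ≤ 1 := fun j ↦ by rw [hGdef, coeff_map]; exact hjOle _
  have hTle : ∀ n, ‖coeff n T'‖ ≤ 1 := fun n ↦ by rw [hT'def, coeff_map]; exact hjOle _
  -- norms of the constants
  have hp1R : (1 : ℝ) < p := by exact_mod_cast (Fact.out : p.Prime).one_lt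
  have hp0R : (0 : ℝ) < p := by positivity
  have hπk : ‖jO (πO ^ k)‖ = ‖π‖ ^ k := by rw [map_pow, norm_pow, hjO, hπOc]
  have hπpos : 0 < ‖π‖ := by
    rw [norm_pos_iff, hπdef]
    intro h0
    exact πu.ne_zero (by exact_mod_cast h0)
  -- `p ∤ n₁` (as `p ∣ d` and `n₁, d` are coprime), so `‖n₁‖ = 1`
  have hn₁cop : p.Coprime n₁ := by
    have hred : u.num.natAbs.Coprime u.den := u.reduced
    have hn₁abs : n₁ = u.num.natAbs := by
      rw [hn₁]; omega
    rw [Nat.coprime_comm, hn₁abs]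
    refine Nat.Coprime.coprime_dvd_right ?_ hred
    rw [← hd]; exact ⟨d₂, hd₂⟩
  have hn₁norm : ‖((n₁ : ℕ) : PadicAlgCl p)‖ = 1 := by
    rw [show ((n₁ : ℕ) : PadicAlgCl p) = (((n₁ : ℕ) : ℚ_[p]) : PadicAlgCl p) by push_cast; rfl,
      PadicAlgCl.norm_extends, Padic.norm_natCast_eq_one_iff]
    exact hn₁cop
  have hpnorm : ‖((p : ℕ) : PadicAlgCl p)‖ = (p : ℝ)⁻¹ := by
    rw [show ((p : ℕ) : PadicAlgCl p) = (((p : ℕ) : ℚ_[p]) : PadicAlgCl p) by push_cast; rfl,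
      PadicAlgCl.norm_extends, Padic.norm_p]
  -- `‖d₂‖·‖u‖ = p`: from `d·u = n₁`, `d = p d₂`
  set uA : PadicAlgCl p := (((u : ℚ) : ℚ_[p]) : PadicAlgCl p) with huA
  have hφQuA : ((φQ u : K) : PadicAlgCl p) = uA := by
    have hφQu : φQ u = φK ((u : ℚ) : ℚ_[p]) := by
      rw [← hcomp, RingHom.comp_apply, hφ, eq_ratCast]
    rw [hφQu, huA, hφK, IntermediateField.coe_algebraMap_apply]
  have hduA : ((d : ℕ) : PadicAlgCl p) * uA = (n₁ : ℕ) := by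
    have h := congrArg (fun y : K ↦ (y : PadicAlgCl p)) hdu
    push_cast at h
    rwa [hφQuA] at h
  have hd₂u : ‖((d₂ : ℕ) : PadicAlgCl p)‖ * ‖uA‖ = p := by
    have h := congrArg norm hduA
    rw [norm_mul, hn₁norm, hd₂, Nat.cast_mul, norm_mul, hpnorm] at h
    field_simp at h
    linarith [h]
  -- domination: `‖[qⁿ]S‖ ≤ ‖π‖ᵏ = ‖[q¹]S‖`
  have hS1 : coeff 1 (G.subst T') = jO (πO ^ k) * (((d : ℕ) : PadicAlgCl p) * uA) := by
    rw [hGT, coeff_map, hSdef, coeff_one_subst_eq_mul _ ht₃0, coeff_one_formalMul', map_mul,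
      map_natCast, show jO (coeff 1 t₃) = ((algebraMap (padicCoeffRing K) K (coeff 1 t₃) : K) : PadicAlgCl p)
        from rfl, h1]
    push_cast
    rw [hφQuA, hjO, ← hπOc]
    push_cast
    ring
  have hS1norm : ‖coeff 1 (G.subst T')‖ = ‖π‖ ^ k := by
    rw [hS1, norm_mul, hπk, hduA, hn₁norm, mul_one]
  have hdom : ∀ n, ‖coeff n (G.subst T')‖ ≤ ‖coeff 1 (G.subst T')‖ := by
    intro n
    rw [hS1norm, hGT, coeff_map, hSfac, coeff_C_mul, map_mul, norm_mul, hπk]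
    exact mul_le_of_le_one_right (pow_nonneg (norm_nonneg _) k) (hjOle _)
  -- the sharp lemma, root form, with `R = ρ₀`
  have hb1 : coeff 1 G ≠ 0 := by
    rw [hGdef, coeff_map, coeff_one_formalMul', map_natCast]
    exact_mod_cast (Fact.out : p.Prime).ne_zero
  have hGi : coeff i G = jO (coeff i (V''.formalMul p)) := by rw [hGdef, coeff_map]
  have hroot : ‖coeff 1 G‖ ≤ ‖coeff i G‖ * ρ₀ ^ (i - 1) := by
    rw [hGdef, coeff_map, coeff_one_formalMul', map_natCast, hpnorm, coeff_map, hjO]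
    exact hsl
  have hle := Literature.RingTheory.PowerSeries.norm_coeff_one_le_of_subst_dominated hGle hTle hG0 hT'0
    hdom hb1 hρ₀ hi hroot
  -- but `‖[q¹]T'‖ = ‖d₂ πᵏ u‖ = p ‖π‖ᵏ > ρ₀`
  have hT'1 : ‖coeff 1 T'‖ = p * ‖π‖ ^ k := by
    rw [hT'def, coeff_map, hT1, map_mul, map_natCast,
      show jO (coeff 1 t₃) = ((algebraMap (padicCoeffRing K) K (coeff 1 t₃) : K) : PadicAlgCl p) from rfl,
      h1]
    push_cast
    rw [hφQuA, norm_mul, norm_mul, norm_pow, ← hπdef]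
    calc ‖((d₂ : ℕ) : PadicAlgCl p)‖ * (‖π‖ ^ k * ‖uA‖) = (‖((d₂ : ℕ) : PadicAlgCl p)‖ * ‖uA‖) * ‖π‖ ^ k := by ring
      _ = p * ‖π‖ ^ k := by rw [hd₂u]
  rw [hT'1] at hle
  exact absurd (hle.trans_lt hρ₀lt) (lt_irrefl _)

set_option maxHeartbeats 400000 in
/-- **The Manin-constant multiplier is a `p`-adic integer at a prime with a Honda witness and a
finite-height twist over a finite extension carrying a slope beyond `ν − 1` — every `p`, every
`k`, model-free.** Data: those of `edixhoven_int_of_neronLattice_eq_smul_periodLattice`; a Honda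
witness at `p`; `K/ℚ_p` finite inside `ℚ̄_p`, `O = padicCoeffRing K`, a unit `π` of `K` with
`‖π‖ᵉ = p⁻¹`, ANY `k`, `r, s, t ∈ O`, an `O`-curve `V''` with `V'' ⊗ K = (πᵏ, r, s, t) • (W' ⊗ K)`
of finite height, and a slope (†) of `[p]_{V''}`: `p⁻¹ ≤ ‖bᵢ‖ρ₀^{i−1}`, `0 ≤ ρ₀ < p‖π‖ᵏ`, `i ≥ 2`.
Then `‖q‖_p ≤ 1`. (Steps 1–4 of `ManinConstantSemistableTwistProofs` verbatim, then
`padicNorm_le_one_of_formalLog_subst_eq_of_semistableTwist_of_slope`.)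
[cite: EdixhovenManin1991, Prop. 2] [cite: Honda1970, Thm. 2 (p. 223) and Thm. 9 (pp. 240–241)]
[cite: PastenShimura2024, §10.1 (p. 33)] -/
theorem padicNorm_le_one_of_neronLattice_eq_smul_periodLattice_of_semistableTwist_of_slope
    {N : ℕ} [NeZero N]
    {W' : WeierstrassCurve ℚ} [W'.IsElliptic] [W'.IsGloballyMinimal] {f : CuspForm (Gamma0 N) 2}
    {L' : PeriodPair} (hf : IsNewformOf W' f) (hL' : IsNeronLatticeOf (W'.baseChange ℂ) L')
    {q : ℚ} (hq : ∀ z ∈ periodLattice f, (q : ℂ) * z ∈ L'.lattice)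
    (hq' : ∀ z ∈ L'.lattice, ∃ w ∈ periodLattice f, z = q * w)
    {p : ℕ} [Fact p.Prime]
    (hψex : ∃ ψ : ℚ_[p]⟦X⟧, constantCoeff ψ = 0 ∧ (∀ n, ‖coeff n ψ‖ ≤ 1) ∧
      (W'.map (algebraMap ℚ ℚ_[p])).formalLog.subst ψ =
        PowerSeries.mk fun k ↦ ((W'.LFunction k : ℤ) : ℚ_[p]) / k)
    (K : IntermediateField ℚ_[p] (PadicAlgCl p)) [FiniteDimensional ℚ_[p] K]
    (πu : Kˣ) {e k : ℕ} (hπe : ‖((πu : K) : PadicAlgCl p)‖ ^ e = (p : ℝ)⁻¹)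
    (r s t : padicCoeffRing K) (V'' : WeierstrassCurve (padicCoeffRing K))
    (hV'' : V''.map (algebraMap (padicCoeffRing K) K) =
      (⟨πu ^ k, (r : K), (s : K), (t : K)⟩ : VariableChange K) • W'.map (algebraMap ℚ K))
    (hfin : ∃ J : ℕ, 0 < J ∧ IsUnit (coeff J (V''.formalMul p)))
    (hslope : ∃ (i : ℕ) (ρ₀ : ℝ), 2 ≤ i ∧ 0 ≤ ρ₀ ∧ ρ₀ < p * ‖((πu : K) : PadicAlgCl p)‖ ^ k ∧
      (p : ℝ)⁻¹ ≤ ‖(((coeff i (V''.formalMul p) : padicCoeffRing K) : K) : PadicAlgCl p)‖ * ρ₀ ^ (i - 1)) :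
    ‖(q : ℚ_[p])‖ ≤ 1 := by
  /- Step 1: lattices. `q ≠ 0`, `L := q⁻¹ L'` spans `Λ_f`, the short model `E` of `ℂ/Λ_f`. -/
  have hq0 : q ≠ 0 := by
    rintro rfl
    obtain ⟨w, -, hw⟩ := hq' L'.ω₁ L'.ω₁_mem_lattice
    rw [Rat.cast_zero, zero_mul] at hw
    exact (LinearIndependent.ne_zero 0 L'.indep) (by simpa using hw)
  have hqC : (q : ℂ) ≠ 0 := by exact_mod_cast hq0
  set L : PeriodPair := L'.mulLeft ((q : ℂ)⁻¹) (inv_ne_zero hqC) with hLdef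
  have hL : ∀ x, x ∈ L.lattice ↔ x ∈ periodLattice f := fun x ↦ by
    rw [hLdef, PeriodPair.mem_mulLeft_lattice, inv_inv]
    constructor
    · intro hx
      obtain ⟨w, hw, hxw⟩ := hq' _ hx
      rwa [mul_left_cancel₀ hqC hxw]
    · exact hq x
  have hΛ : L'.lattice = (L.mulLeft (q : ℂ) hqC).lattice := by
    ext z
    rw [PeriodPair.mem_mulLeft_lattice, hL]
    constructor
    · intro hz
      obtain ⟨w, hw, rfl⟩ := hq' z hz
      rwa [← mul_assoc, inv_mul_cancel₀ hqC, one_mul]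
    · intro hz
      have h := hq _ hz
      rwa [← mul_assoc, mul_inv_cancel₀ hqC, one_mul] at h
  have hf0 : f ≠ 0 := hf.1.ne_zero
  have ha : ∀ n, ((W'.LFunction n : ℤ) : ℂ) = cuspCoeff f n := fun n ↦ (hf.2 n).symm
  have hrat : ∀ n, ∃ r : ℚ, (r : ℂ) = cuspCoeff f n := fun n ↦
    ⟨(W'.LFunction n : ℚ), by rw [← ha n, Rat.cast_intCast]⟩
  obtain ⟨⟨q₂, hq₂⟩, ⟨q₃, hq₃⟩⟩ :=
    PeriodPair.ratCast_g₂_g₃_of_lattice_eq_periodLattice f hf0 hrat L hL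
  set a₄ : ℚ := -q₂ / 4 with ha₄
  set a₆ : ℚ := -q₃ / 4 with ha₆
  have h₂ : L.g₂ = -4 * (a₄ : ℂ) := by rw [← hq₂, ha₄]; push_cast; ring
  have h₃ : L.g₃ = -4 * (a₆ : ℂ) := by rw [← hq₃, ha₆]; push_cast; ring
  set E : WeierstrassCurve ℚ := { a₁ := 0, a₂ := 0, a₃ := 0, a₄ := a₄, a₆ := a₆ } with hE
  haveI hEe : E.IsElliptic := isElliptic_shortModel h₂ h₃
  have hEL : IsNeronLatticeOf (E.baseChange ℂ) L := isNeronLatticeOf_shortModel h₂ h₃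
  /- Step 2: the modular parametrisation as a formal series `z ∈ Xℚ⟦X⟧ ∩ Frac ℤ⟦X⟧`, with
  `w_E(z) ∈ Frac ℤ⟦X⟧` as well (the `x,y`-dictionary). -/
  obtain ⟨z, P, Q, P₂, Q₂, hz0, hQ, hPQ, hQ₂, hPQ₂, hlog⟩ := exists_rat_series_formalLog_subst_eq_formalW f hf0
    (W'.LFunction : ℕ → ℤ) ha L (fun x hx ↦ (hL x).mpr hx) a₄ a₆ h₂ h₃
  /- Step 3: `C • E = W'` over `ℚ` with `0 < u(C)` and `‖u(C)‖_p = ‖q‖_p`. -/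
  obtain ⟨e₄, e₆⟩ := hL'.c₄_eq_of_lattice_eq_mulLeft hqC hΛ
  have hc₄E : (E.baseChange ℂ).c₄ = (E.c₄ : ℂ) := by
    simp [WeierstrassCurve.baseChange, WeierstrassCurve.map_c₄]
  have hc₆E : (E.baseChange ℂ).c₆ = (E.c₆ : ℂ) := by
    simp [WeierstrassCurve.baseChange, WeierstrassCurve.map_c₆]
  have h₄ : W'.c₄ = (q ^ 4)⁻¹ * E.c₄ := by
    have h : ((W'.c₄ : ℚ) : ℂ) = (((q ^ 4)⁻¹ * E.c₄ : ℚ) : ℂ) := by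
      rw [e₄, hEL.1, hc₄E]; push_cast; ring
    exact_mod_cast h
  have h₆ : W'.c₆ = (q ^ 6)⁻¹ * E.c₆ := by
    have h : ((W'.c₆ : ℚ) : ℂ) = (((q ^ 6)⁻¹ * E.c₆ : ℚ) : ℂ) := by
      rw [e₆, hEL.2, hc₆E]; push_cast; ring
    exact_mod_cast h
  obtain ⟨vc, hC, hCpos⟩ : ∃ vc : VariableChange ℚ, vc • E = W' ∧ 0 < (vc.u : ℚ) := by
    obtain ⟨vc, hC⟩ := exists_variableChange_of_c₄_eq_of_c₆_eq hq0 h₄ h₆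
    rcases lt_or_gt_of_ne vc.u.ne_zero with hneg | hpos
    · have hE' : (⟨-1, 0, 0, 0⟩ : VariableChange ℚ) • E = E := by
        rw [hE, smul_shortModel, inv_neg_one]
        congr 1 <;> push_cast <;> ring
      refine ⟨vc * ⟨-1, 0, 0, 0⟩, by rw [mul_smul, hE', hC], ?_⟩
      show 0 < ((vc.u * -1 : ℚˣ) : ℚ)
      rw [Units.val_mul, Units.val_neg, Units.val_one]
      linarith
    · exact ⟨vc, hC, hpos⟩
  have hCu0 : (vc.u : ℚ) ≠ 0 := vc.u.ne_zero
  -- `‖u(vc)‖_p = ‖q‖_p`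
  have hnorm : ‖((vc.u : ℚ) : ℚ_[p])‖ = ‖(q : ℚ_[p])‖ := by
    have hW4 : W'.c₄ = ((vc.u : ℚ))⁻¹ ^ 4 * E.c₄ := by
      rw [← hC, variableChange_c₄, Units.val_inv_eq_inv_val]
    have hW6 : W'.c₆ = ((vc.u : ℚ))⁻¹ ^ 6 * E.c₆ := by
      rw [← hC, variableChange_c₆, Units.val_inv_eq_inv_val]
    have hΔ : E.c₄ ≠ 0 ∨ E.c₆ ≠ 0 := by
      by_contra hcon
      rw [not_or, not_not, not_not] at hcon
      have h1728 := E.c_relation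
      rw [hcon.1, hcon.2] at h1728
      exact E.isUnit_Δ.ne_zero (by linear_combination (1 / 1728 : ℚ) * h1728)
    have key : (vc.u : ℚ) ^ 4 = q ^ 4 ∨ (vc.u : ℚ) ^ 6 = q ^ 6 := by
      rcases hΔ with hc | hc
      · left
        have h' := mul_right_cancel₀ hc (hW4.symm.trans h₄)
        rw [inv_pow] at h'
        exact inv_injective h'
      · right
        have h' := mul_right_cancel₀ hc (hW6.symm.trans h₆)
        rw [inv_pow] at h'
        exact inv_injective h'
    rcases key with h | h
    · have h' : ‖((vc.u : ℚ) : ℚ_[p])‖ ^ 4 = ‖(q : ℚ_[p])‖ ^ 4 := by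
        rw [← norm_pow, ← norm_pow, ← Rat.cast_pow, ← Rat.cast_pow, h]
      exact (pow_left_inj₀ (norm_nonneg _) (norm_nonneg _) (by norm_num)).mp h'
    · have h' : ‖((vc.u : ℚ) : ℚ_[p])‖ ^ 6 = ‖(q : ℚ_[p])‖ ^ 6 := by
        rw [← norm_pow, ← norm_pow, ← Rat.cast_pow, ← Rat.cast_pow, h]
      exact (pow_left_inj₀ (norm_nonneg _) (norm_nonneg _) (by norm_num)).mp h'
  rw [← hnorm]
  /- Step 4: the parameter `t₀ = θ_C(z)` of `W'` over `ℚ`: `[X¹]t₀ = u`, `log_{W'}(t₀) = u·ℓ`,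
  and `t₀, w_{W'}(t₀) ∈ Frac ℤ⟦X⟧` by the dictionary. -/
  have hz1 : coeff 1 z = 1 := by
    have h1 := congrArg (coeff 1) hlog
    rwa [coeff_one_subst_eq_mul _ hz0, coeff_one_formalLog, one_mul, coeff_mk, Nat.cast_one,
      div_one, W'.isMultiplicative_LFunction.map_one, Int.cast_one] at h1
  set t₀ : ℚ⟦X⟧ := (E.formalVariableChange vc).subst z with ht₀
  have ht₀0 : constantCoeff t₀ = 0 :=
    (constantCoeff_subst_eq_constantCoeff hz0).trans (E.constantCoeff_formalVariableChange vc)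
  have ht₀1 : coeff 1 t₀ = (vc.u : ℚ) := by
    rw [ht₀, E.coeff_one_formalVariableChange_subst vc hz0, hz1, mul_one]
  have hlog₀ : W'.formalLog.subst t₀ = C (vc.u : ℚ) * PowerSeries.mk fun n ↦ ((W'.LFunction n : ℤ) : ℚ) / n := by
    rw [ht₀, ← hlog, ← hC]
    exact E.formalLog_subst_formalVariableChange_subst vc hz0
  obtain ⟨P', Q', hQ', hPQ'⟩ := E.exists_int_frac_formalVariableChange_subst vc hz0 hQ hPQ hQ₂ hPQ₂
  obtain ⟨P₂', Q₂', hQ₂', hPQ₂'⟩ := E.exists_int_frac_formalW_smul_subst vc hz0 hQ hPQ hQ₂ hPQ₂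
  rw [← ht₀] at hPQ'
  rw [hC, ← ht₀] at hPQ₂'
  /- Steps 5–10: the local step over `O = 𝒪_K`, slope form. -/
  exact padicNorm_le_one_of_formalLog_subst_eq_of_semistableTwist_of_slope W' hCpos ht₀0 ht₀1 hlog₀ hQ'
    hPQ' hQ₂' hPQ₂' hψex K πu hπe r s t V'' hV'' hfin hslope

/-- **The same at an additive prime, where the Honda witness is free** (`p ∣ Δ_min(W')`,
`p ∣ c₄(W')`; `exists_padicInt_formalLog_subst_eq_lSeriesLog_of_dvd_of_dvd`): a finite-height twist
over some `𝒪_K` with a slope of `[p]` beyond `ν − 1` gives `‖q‖_p ≤ 1` — every `p` and every twist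
exponent, in particular the wild types at `2` and `3`. [cite: EdixhovenManin1991, Prop. 2]
[cite: Honda1970, Thm. 2 (p. 223)] -/
theorem padicNorm_le_one_of_neronLattice_eq_smul_periodLattice_of_semistableTwist_of_slope_of_dvd_of_dvd
    {N : ℕ} [NeZero N]
    {W' : WeierstrassCurve ℚ} [W'.IsElliptic] [W'.IsGloballyMinimal] {f : CuspForm (Gamma0 N) 2}
    {L' : PeriodPair} (hf : IsNewformOf W' f) (hL' : IsNeronLatticeOf (W'.baseChange ℂ) L')
    {q : ℚ} (hq : ∀ z ∈ periodLattice f, (q : ℂ) * z ∈ L'.lattice)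
    (hq' : ∀ z ∈ L'.lattice, ∃ w ∈ periodLattice f, z = q * w)
    {p : ℕ} [Fact p.Prime] (hΔ : (p : ℤ) ∣ minimalDiscriminantInt W')
    (hc₄ : (p : ℤ) ∣ (integralModelInt W').c₄)
    (K : IntermediateField ℚ_[p] (PadicAlgCl p)) [FiniteDimensional ℚ_[p] K]
    (πu : Kˣ) {e k : ℕ} (hπe : ‖((πu : K) : PadicAlgCl p)‖ ^ e = (p : ℝ)⁻¹)
    (r s t : padicCoeffRing K) (V'' : WeierstrassCurve (padicCoeffRing K))
    (hV'' : V''.map (algebraMap (padicCoeffRing K) K) =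
      (⟨πu ^ k, (r : K), (s : K), (t : K)⟩ : VariableChange K) • W'.map (algebraMap ℚ K))
    (hfin : ∃ J : ℕ, 0 < J ∧ IsUnit (coeff J (V''.formalMul p)))
    (hslope : ∃ (i : ℕ) (ρ₀ : ℝ), 2 ≤ i ∧ 0 ≤ ρ₀ ∧ ρ₀ < p * ‖((πu : K) : PadicAlgCl p)‖ ^ k ∧
      (p : ℝ)⁻¹ ≤ ‖(((coeff i (V''.formalMul p) : padicCoeffRing K) : K) : PadicAlgCl p)‖ * ρ₀ ^ (i - 1)) :
    ‖(q : ℚ_[p])‖ ≤ 1 :=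
  padicNorm_le_one_of_neronLattice_eq_smul_periodLattice_of_semistableTwist_of_slope hf hL' hq hq'
    (W'.exists_padicInt_formalLog_subst_eq_lSeriesLog_of_dvd_of_dvd hΔ hc₄) K πu hπe r s t V'' hV''
    hfin hslope


end Literature.NumberTheory.EllipticCurves
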